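import Mathlib.Analysis.Calculus.IteratedDeriv.Lemmas
import Mathlib.Algebra.Polynomial.Roots
import Literature.NumberTheory.LFunctions.WeilCriterionConverse
import Literature.NumberTheory.LFunctions.WeilExplicitFormulaProofs
import HarnessLib

/-!
# Route `RuelleBand`, crux `CofiniteCriticalLine`, line `cofinite-weil-index-staircase` —
the stub `stub_cofiniteWeilCriterion` (THE COFINITE WEIL CRITERION, orbit form)

Registered stub of the skeleton of the line `cofinite-weil-index-staircase` for the crux
`Summit.RiemannHypothesis.RiemannHypothesis.Theses.RuelleBand.CofiniteCriticalLine`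
(item stmt-RiemannHypothesis-2064), proved BY NAME with the registered signature: if there is `D`
such that every test function `f` admits a non-zero polynomial `p` of degree `≤ D` with
`Re Q ≥ 0` (`Q = weilQuadratic`) on the translation span of
`h := p(-D) f = ∑_{j ≤ deg p} coeff_j (-1)^j f^{(j)}`, then
`{s | ζ s = 0 ∧ 0 < Re s < 1 ∧ Re s ≠ 1/2}` is finite.

Proof. Positivity on the span contains positivity at `h` and at every
`translateMix h c x = h + c h(· - x)`, which is all that the tree's proof of the converse Weil
criterion (`WeilConverse.norm_expSum_le`, `WeilConverse.order_mul_pairCoeff_eq_zero`; Bombieri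
2000 Thm. 1, "if" half, via Laplace transform + identity theorem,
`BoundedPowerSum.sum_fiber_eq_zero_of_exp_real`) uses; with `zeroForm = Q` on tests (the PROVED
explicit formula `explicit_formula_holds`) this kills `m(ρ) P_h(ρ)` at every non-trivial zero `ρ`
OFF the line, where `P_h(ρ) = p(ρ - 1/2) conj p(1/2 - ρ̄) P_f(ρ)` (`ĥ(s) = p(s - 1/2) f̂(s)`,
`weilMellin_deriv` iterated) and `m(ρ) ≥ 1`. So every off-line zero `ρ` with `P_f(ρ) ≠ 0` lies in
the finset `(roots p + 1/2) ∪ (1/2 - conj (roots p))` of cardinality `≤ 2 deg p ≤ 2D`. If the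
off-line set were infinite, take `2D + 1` of its points, `Y` a bound for their ordinates and `f` a
narrow bump with `Re f̂ > 0` on the strip `|Im s| ≤ Y`, so that `P_f(ρ) = f̂(ρ) conj f̂(1 - ρ̄) ≠ 0`
at each of them: `2D + 1 ≤ 2D`, absurd. Only OFF-line coefficients die (`Re (ρ - 1/2) ≠ 0` in the
fibre lemma); zeros on the line are never counted.

References: E. Bombieri, *Remarks on Weil's quadratic functional in the theory of prime numbers
I*, Rend. Lincei (9) 11 (2000), 183–233, §3 Thm. 1; A. Weil (1952).
-/

set_option linter.dupNamespace false

noncomputable section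

open Complex MeasureTheory Filter Set
open scoped BigOperators Topology ComplexConjugate

namespace Summit.RiemannHypothesis.RiemannHypothesis.Theorems.RuelleBandCofiniteCriticalLine

open Literature.NumberTheory.LFunctions

/-- For every `Y` there is a test function `g` (a narrow non-negative bump at `0`, support
`|t| < 1/(1 + |Y|)`) with `Re ĝ(σ + iγ) > 0` for every real `σ` and every `|γ| ≤ Y`: on the support
`|γ t| ≤ 1`, so `cos(γ t) ≥ 0`, and the integrand is positive at `t = 0`
(cf. `exists_isWeilTest_re_weilMellin_pos`, one ordinate). [folklore] -/
theorem stub_cofiniteWeilCriterion_bump (Y : ℝ) :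
    ∃ g : ℝ → ℂ, IsWeilTest g ∧ ∀ σ γ : ℝ, |γ| ≤ Y → 0 < (weilMellin g (σ + γ * I)).re := by
  -- adapted from `exists_isWeilTest_re_weilMellin_pos` (Literature/…/WeilMellinBounds.lean)
  set δ : ℝ := 1 / (1 + |Y|) with hδ
  have hδpos : 0 < δ := by positivity
  let b : ContDiffBump (0 : ℝ) := ⟨δ / 2, δ, by positivity, by linarith⟩
  refine ⟨fun t ↦ ((b t : ℝ) : ℂ), ⟨?_, ?_⟩, fun σ γ hγ ↦ ?_⟩
  · exact Complex.ofRealCLM.contDiff.comp b.contDiff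
  · exact b.hasCompactSupport.comp_left Complex.ofReal_zero
  · set F : ℝ → ℝ := fun t ↦ b t * Real.exp ((σ - 1 / 2) * t) * Real.cos (γ * t) with hF
    have hint : Integrable fun t : ℝ ↦ ((b t : ℝ) : ℂ) * cexp ((σ + γ * I - 1 / 2) * t) :=
      integrable_weilIntegrand (Complex.continuous_ofReal.comp b.continuous)
        (b.hasCompactSupport.comp_left Complex.ofReal_zero) _
    have hre : ∀ t : ℝ, (((b t : ℝ) : ℂ) * cexp ((σ + γ * I - 1 / 2) * t)).re = F t := by
      intro t
      rw [Complex.re_ofReal_mul, Complex.exp_re]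
      have h1 : ((σ + γ * I - 1 / 2) * (t : ℂ)).re = (σ - 1 / 2) * t := by
        simp [sub_re, add_re, mul_re]
      have h2 : ((σ + γ * I - 1 / 2) * (t : ℂ)).im = γ * t := by
        simp [sub_im, add_im, mul_im]
      rw [h1, h2, hF]
      ring
    unfold weilMellin
    have hI := integral_re hint
    simp only [RCLike.re_to_complex] at hI
    beta_reduce
    rw [← hI]
    simp_rw [hre]
    have hFc : Continuous F := by
      simp only [hF]
      have hb := b.continuous
      fun_prop
    have hFsupp : HasCompactSupport F := by
      simp only [hF]
      exact (b.hasCompactSupport.mul_right).mul_right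
    have hFnn : 0 ≤ F := by
      intro t
      simp only [hF, Pi.zero_apply]
      by_cases ht : |t| < δ
      · refine mul_nonneg (mul_nonneg (b.nonneg' t) (Real.exp_pos _).le)
          (Real.cos_nonneg_of_mem_Icc ?_)
        have hγt : |γ * t| ≤ 1 := by
          rw [abs_mul]
          calc |γ| * |t| ≤ |γ| * δ := mul_le_mul_of_nonneg_left ht.le (abs_nonneg _)
            _ ≤ |Y| * δ := mul_le_mul_of_nonneg_right (hγ.trans (le_abs_self Y)) hδpos.le
            _ = |Y| / (1 + |Y|) := by rw [hδ]; ring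
            _ ≤ 1 := by rw [div_le_one (by positivity)]; linarith [abs_nonneg Y]
        constructor <;> nlinarith [abs_le.1 hγt, Real.pi_gt_three]
      · have hb : b t = 0 := b.zero_of_le_dist (by simpa [Real.dist_eq] using not_lt.1 ht)
        simp [hb]
    have hF0 : F 0 ≠ 0 := by
      have hb0 : b 0 = 1 := b.one_of_mem_closedBall (by simp [b]; positivity)
      simp [hF, hb0]
    exact hFc.integral_pos_of_hasCompactSupport_nonneg_nonzero hFsupp hFnn hF0

/-- `Q(g) = ∑_ρ m(ρ) P_g(ρ)` for a test function `g`: both `WeilConverse.zeroForm g`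
(`WeilConverse.hasWeilZeroSide_zeroForm`) and `weilQuadratic g = W(g ⋆ g̃)` (the PROVED explicit
formula `explicit_formula_holds` at `g ⋆ g̃`) are the limit of the symmetric partial zero sums of
`g ⋆ g̃`. [cite: Bombieri2000Weil, Thm. 2] -/
theorem stub_cofiniteWeilCriterion_zeroForm_eq {g : ℝ → ℂ} (hg : IsWeilTest g) :
    WeilConverse.zeroForm g = weilQuadratic g :=
  tendsto_nhds_unique (WeilConverse.hasWeilZeroSide_zeroForm hg)
    (explicit_formula_holds (hg.weilConv hg.weilReflect))

/-- **`|B_g(x)| ≤ Re Q(g)`** when `Re Q ≥ 0` on all of `translateMix g c x = g + c g_x`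
(`c = 0` gives `Re Q(g) ≥ 0`; then expand `Re Q(g + c g_x) ≥ 0` with
`c = -conj B_g(x)/|B_g(x)|`; copy of `WeilConverse.norm_expSum_le`). [folklore] -/
theorem stub_cofiniteWeilCriterion_norm_expSum_le {g : ℝ → ℂ} (hg : IsWeilTest g)
    (Hloc : ∀ (c : ℂ) (x : ℝ), 0 ≤ (weilQuadratic (WeilConverse.translateMix g c x)).re)
    (x : ℝ) : ‖WeilConverse.expSum g x‖ ≤ (WeilConverse.zeroForm g).re := by
  -- adapted from `WeilConverse.norm_expSum_le` (Literature/…/WeilCriterionConverse.lean)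
  have hQ : 0 ≤ (WeilConverse.zeroForm g).re := by
    have h := Hloc 0 x
    have e : WeilConverse.translateMix g 0 x = g := by
      funext t
      simp [WeilConverse.translateMix]
    rw [e] at h
    rwa [stub_cofiniteWeilCriterion_zeroForm_eq hg]
  set B := WeilConverse.expSum g x with hBdef
  by_cases hB : B = 0
  · rw [hB, norm_zero]; exact hQ
  have hA : WeilConverse.expSum' g x = conj B := by
    rw [hBdef, ← WeilConverse.conj_expSum' g x, Complex.conj_conj]
  have hn0 : ‖B‖ ≠ 0 := norm_ne_zero_iff.2 hB
  have hn : (‖B‖ : ℂ) ≠ 0 := by exact_mod_cast hn0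
  set c : ℂ := -conj B / (‖B‖ : ℂ) with hc
  have hcB : c * B = -(‖B‖ : ℂ) := by
    rw [hc, div_mul_eq_mul_div, neg_mul, Complex.conj_mul', neg_div]
    congr 1
    rw [sq, mul_div_assoc, div_self hn, mul_one]
  have hc1 : Complex.normSq c = 1 := by
    rw [Complex.normSq_eq_norm_sq, hc, norm_div, norm_neg, Complex.norm_conj, Complex.norm_real,
      Real.norm_eq_abs, abs_norm, div_self hn0, one_pow]
  have h0 : 0 ≤ (WeilConverse.zeroForm (WeilConverse.translateMix g c x)).re := by
    rw [stub_cofiniteWeilCriterion_zeroForm_eq (WeilConverse.isWeilTest_translateMix hg c x)]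
    exact Hloc c x
  rw [WeilConverse.zeroForm_translateMix hg c x, hA, ← map_mul, hcB, hc1] at h0
  simp only [map_neg, Complex.conj_ofReal, Complex.ofReal_one, one_mul, add_re, neg_re,
    Complex.ofReal_re] at h0
  linarith

/-- **`m(ρ₀) P_g(ρ₀) = 0` at every non-trivial zero `ρ₀` off the critical line** when
`Re Q ≥ 0` on all of `translateMix g c x`: `BoundedPowerSum.sum_fiber_eq_zero_of_exp_real`
applied to the bounded series `B_g` (exponents `ρ - 1/2`, locally finite; the fibre over
`ρ₀ - 1/2` is `{ρ₀}` and `Re (ρ₀ - 1/2) ≠ 0`; copy of `WeilConverse.order_mul_pairCoeff_eq_zero`).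
Only OFF-line coefficients die. [folklore] -/
theorem stub_cofiniteWeilCriterion_order_mul_pairCoeff_eq_zero {g : ℝ → ℂ} (hg : IsWeilTest g)
    (Hloc : ∀ (c : ℂ) (x : ℝ), 0 ≤ (weilQuadratic (WeilConverse.translateMix g c x)).re)
    {ρ₀ : ℂ} (hρ₀ : ρ₀ ∈ ZetaZeros.riemannZetaNontrivialZeros) (hre : ρ₀.re ≠ 1 / 2) :
    (riemannZetaZeroOrder ρ₀ : ℂ) * WeilConverse.pairCoeff g ρ₀ = 0 := by
  -- adapted from `WeilConverse.order_mul_pairCoeff_eq_zero` (Literature/…/WeilCriterionConverse)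
  have h := Literature.Analysis.Complex.BoundedPowerSum.sum_fiber_eq_zero_of_exp_real
    (ι := ZetaZeros.riemannZetaNontrivialZeros)
    (c := fun ρ ↦ (riemannZetaZeroOrder (ρ : ℂ) : ℂ) * WeilConverse.pairCoeff g ρ)
    (lam := fun ρ ↦ (ρ : ℂ) - 1 / 2) (R := 1 / 2) (M := (WeilConverse.zeroForm g).re)
    (WeilConverse.summable_norm_pairCoeff hg) (fun ρ ↦ WeilConverse.abs_re_sub_half_le ρ.2)
    (fun z ↦ ?_) (fun x ↦ stub_cofiniteWeilCriterion_norm_expSum_le hg Hloc x) (μ := ρ₀ - 1 / 2)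
    (by simpa [sub_re] using sub_ne_zero.2 hre) {⟨ρ₀, hρ₀⟩} (fun ρ ↦ ?_)
  · simpa using h
  · refine ⟨1, one_pos, ?_⟩
    refine ((riemannZetaNontrivialZeros_finite_inter_ball (z + 1 / 2) 1).preimage
      (Subtype.val_injective.injOn)).subset fun ρ hρ ↦ ?_
    simp only [mem_setOf_eq, Metric.mem_ball, dist_eq_norm] at hρ
    refine ⟨ρ.2, ?_⟩
    rw [Metric.mem_ball, dist_eq_norm]
    rwa [show (ρ : ℂ) - (z + 1 / 2) = (ρ : ℂ) - 1 / 2 - z by ring]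
  · rw [Finset.mem_singleton, sub_left_inj]
    constructor
    · rintro rfl; rfl
    · intro h; exact Subtype.ext h

/-- Iterated derivatives of a test function `f`: `f^{(j)}` is a test function and
`(f^{(j)})^(s) = (-(s - 1/2))^j f̂(s)` (`IsWeilTest.deriv` and the integration by parts
`weilMellin_deriv`, iterated; the two facts are proved together by one induction). [folklore] -/
theorem stub_cofiniteWeilCriterion_iteratedDeriv {f : ℝ → ℂ} (hf : IsWeilTest f) (s : ℂ) :
    ∀ j : ℕ, IsWeilTest (iteratedDeriv j f) ∧
      weilMellin (iteratedDeriv j f) s = (-(s - 1 / 2)) ^ j * weilMellin f s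
  | 0 => by simpa using hf
  | j + 1 => by
    obtain ⟨h1, h2⟩ := stub_cofiniteWeilCriterion_iteratedDeriv hf s j
    rw [iteratedDeriv_succ, weilMellin_deriv h1, h2, pow_succ]
    exact ⟨h1.deriv, by ring⟩

/-- Finite sums of test functions are test functions. [folklore] -/
theorem stub_cofiniteWeilCriterion_isWeilTest_sum {ι : Type*} (F : ι → ℝ → ℂ) (s : Finset ι)
    (hF : ∀ i ∈ s, IsWeilTest (F i)) : IsWeilTest (fun t ↦ ∑ i ∈ s, F i t) := by
  classical
  induction s using Finset.induction_on with
  | empty =>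
    simp only [Finset.sum_empty]
    exact ⟨contDiff_const, HasCompactSupport.zero⟩
  | insert a s ha ih =>
    simp_rw [Finset.sum_insert ha]
    exact (hF a (Finset.mem_insert_self a s)).add
      (ih fun i hi ↦ hF i (Finset.mem_insert_of_mem hi))

/-- The transform of a finite sum of test functions is the sum of the transforms. [folklore] -/
theorem stub_cofiniteWeilCriterion_weilMellin_sum {ι : Type*} (F : ι → ℝ → ℂ) (s : Finset ι)
    (hF : ∀ i ∈ s, IsWeilTest (F i)) (z : ℂ) :
    weilMellin (fun t ↦ ∑ i ∈ s, F i t) z = ∑ i ∈ s, weilMellin (F i) z := by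
  classical
  induction s using Finset.induction_on with
  | empty => simp [weilMellin]
  | insert a s ha ih =>
    have hF' : ∀ i ∈ s, IsWeilTest (F i) := fun i hi ↦ hF i (Finset.mem_insert_of_mem hi)
    have ha' : IsWeilTest (F a) := hF a (Finset.mem_insert_self a s)
    have hs : IsWeilTest (fun t ↦ ∑ i ∈ s, F i t) :=
      stub_cofiniteWeilCriterion_isWeilTest_sum F s hF'
    simp_rw [Finset.sum_insert ha]
    rw [← ih hF', ← weilMellin_add ha'.1.continuous ha'.2 hs.1.continuous hs.2]
    rfl

/-- The derivative polynomial `p(-D) f = ∑_{j ≤ deg p} coeff_j (-1)^j f^{(j)}` is a test function.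
[folklore] -/
theorem stub_cofiniteWeilCriterion_isWeilTest_polyDeriv {f : ℝ → ℂ} (hf : IsWeilTest f)
    (p : Polynomial ℂ) :
    IsWeilTest (fun t ↦ ∑ j ∈ Finset.range (p.natDegree + 1),
      p.coeff j * (-1 : ℂ) ^ j * iteratedDeriv j f t) :=
  stub_cofiniteWeilCriterion_isWeilTest_sum
    (fun j t ↦ p.coeff j * (-1 : ℂ) ^ j * iteratedDeriv j f t) _
    fun j _ ↦ (stub_cofiniteWeilCriterion_iteratedDeriv hf 0 j).1.const_mul _

/-- **Transform of the derivative polynomial**: `(p(-D) f)^(s) = p(s - 1/2) f̂(s)`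
(`(f^{(j)})^(s) = (-(s-1/2))^j f̂(s)` and `(-1)^j (-(s-1/2))^j = (s-1/2)^j`;
`Polynomial.eval_eq_sum_range`). [folklore] -/
theorem stub_cofiniteWeilCriterion_weilMellin_polyDeriv {f : ℝ → ℂ} (hf : IsWeilTest f)
    (p : Polynomial ℂ) (s : ℂ) :
    weilMellin (fun t ↦ ∑ j ∈ Finset.range (p.natDegree + 1),
      p.coeff j * (-1 : ℂ) ^ j * iteratedDeriv j f t) s = p.eval (s - 1 / 2) * weilMellin f s := by
  rw [stub_cofiniteWeilCriterion_weilMellin_sum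
    (fun j t ↦ p.coeff j * (-1 : ℂ) ^ j * iteratedDeriv j f t) _
    (fun j _ ↦ (stub_cofiniteWeilCriterion_iteratedDeriv hf s j).1.const_mul _),
    Polynomial.eval_eq_sum_range, Finset.sum_mul]
  refine Finset.sum_congr rfl fun j _ ↦ ?_
  have e : (fun t ↦ p.coeff j * (-1 : ℂ) ^ j * iteratedDeriv j f t) =
      fun t ↦ (p.coeff j * (-1 : ℂ) ^ j) * iteratedDeriv j f t := rfl
  rw [e, weilMellin_const_mul, (stub_cofiniteWeilCriterion_iteratedDeriv hf s j).2]
  calc p.coeff j * (-1 : ℂ) ^ j * ((-(s - 1 / 2)) ^ j * weilMellin f s)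
      = p.coeff j * (((-1 : ℂ) * (-(s - 1 / 2))) ^ j) * weilMellin f s := by rw [mul_pow]; ring
    _ = p.coeff j * (s - 1 / 2) ^ j * weilMellin f s := by rw [neg_one_mul, neg_neg]

/-- **The zero-side pairing of the derivative polynomial**:
`P_{p(-D)f}(ρ) = p(ρ - 1/2) · conj p(1/2 - ρ̄) · P_f(ρ)` (`P_g(ρ) = ĝ(ρ) conj ĝ(1 - ρ̄)` and
`1 - ρ̄ - 1/2 = 1/2 - ρ̄`). [folklore] -/
theorem stub_cofiniteWeilCriterion_pairCoeff_polyDeriv {f : ℝ → ℂ} (hf : IsWeilTest f)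
    (p : Polynomial ℂ) (ρ : ℂ) :
    WeilConverse.pairCoeff (fun t ↦ ∑ j ∈ Finset.range (p.natDegree + 1),
      p.coeff j * (-1 : ℂ) ^ j * iteratedDeriv j f t) ρ =
      p.eval (ρ - 1 / 2) * conj (p.eval (1 / 2 - conj ρ)) * WeilConverse.pairCoeff f ρ := by
  rw [WeilConverse.pairCoeff, WeilConverse.pairCoeff,
    stub_cofiniteWeilCriterion_weilMellin_polyDeriv hf,
    stub_cofiniteWeilCriterion_weilMellin_polyDeriv hf, map_mul,
    show (1 - conj ρ - 1 / 2 : ℂ) = 1 / 2 - conj ρ by ring]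
  ring

/-- Positivity of `Re Q` on the translation span of `h = p(-D) f` (the stub's hypothesis at `f`,
instantiated at `n = 2`, nodes `![0, x]`, coefficients `![1, c]`) gives `Re Q(h + c h_x) ≥ 0`,
i.e. positivity at every `translateMix h c x`. [folklore] -/
theorem stub_cofiniteWeilCriterion_hloc {f : ℝ → ℂ} (p : Polynomial ℂ)
    (H : ∀ (n : ℕ) (x : Fin n → ℝ) (c : Fin n → ℂ),
      0 ≤ (weilQuadratic (fun t ↦ ∑ k, c k *
        (∑ j ∈ Finset.range (p.natDegree + 1),
          p.coeff j * (-1 : ℂ) ^ j * iteratedDeriv j f (t - x k)))).re)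
    (c : ℂ) (x : ℝ) :
    0 ≤ (weilQuadratic (WeilConverse.translateMix (fun t ↦ ∑ j ∈ Finset.range (p.natDegree + 1),
      p.coeff j * (-1 : ℂ) ^ j * iteratedDeriv j f t) c x)).re := by
  have e : WeilConverse.translateMix (fun t ↦ ∑ j ∈ Finset.range (p.natDegree + 1),
      p.coeff j * (-1 : ℂ) ^ j * iteratedDeriv j f t) c x =
      fun t ↦ ∑ k : Fin 2, (![1, c] : Fin 2 → ℂ) k *
        (∑ j ∈ Finset.range (p.natDegree + 1),
          p.coeff j * (-1 : ℂ) ^ j * iteratedDeriv j f (t - (![0, x] : Fin 2 → ℝ) k)) := by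
    funext t
    simp [WeilConverse.translateMix, weilTranslate, Fin.sum_univ_two]
  rw [e]
  exact H 2 ![0, x] ![1, c]

/-- If `Re f̂(σ + iγ) > 0` for all real `σ` and all `|γ| ≤ Y`, then
`P_f(ρ) = f̂(ρ) conj f̂(1 - ρ̄) ≠ 0` for every `ρ` with `|Im ρ| ≤ Y` (`ρ` and `1 - ρ̄` have the same
ordinate; cf. `WeilConverse.re_eq_one_half`). [folklore] -/
theorem stub_cofiniteWeilCriterion_pairCoeff_ne_zero {f : ℝ → ℂ} {Y : ℝ}
    (hpos : ∀ σ γ : ℝ, |γ| ≤ Y → 0 < (weilMellin f (σ + γ * I)).re) {ρ : ℂ} (hρ : |ρ.im| ≤ Y) :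
    WeilConverse.pairCoeff f ρ ≠ 0 := by
  have h1 : weilMellin f ρ ≠ 0 := by
    intro h0
    have := hpos ρ.re ρ.im hρ
    rw [show (ρ.re : ℂ) + ρ.im * I = ρ from Complex.re_add_im ρ, h0, Complex.zero_re] at this
    exact lt_irrefl _ this
  have h2 : weilMellin f (1 - conj ρ) ≠ 0 := by
    intro h0
    have := hpos (1 - ρ.re) ρ.im hρ
    rw [show ((1 - ρ.re : ℝ) : ℂ) + ρ.im * I = 1 - conj ρ from ?_, h0, Complex.zero_re] at this
    · exact lt_irrefl _ this
    · apply Complex.ext <;> simp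
  exact mul_ne_zero h1 ((map_ne_zero _).2 h2)

/-- **Off-line zeros seen by `f` sit among `≤ 2 deg p` points.** If `Re Q ≥ 0` on the translation
span of `h = p(-D) f` (`p ≠ 0`), then every non-trivial zero `ρ` with `Re ρ ≠ 1/2` and
`P_f(ρ) ≠ 0` lies in `(roots p + 1/2) ∪ (1/2 - conj (roots p))`: the local converse criterion
kills `m(ρ) P_h(ρ) = m(ρ) p(ρ - 1/2) conj p(1/2 - ρ̄) P_f(ρ)` and `m(ρ) ≥ 1`.
[cite: Bombieri2000Weil, Thm. 1 ("if" half), run inside one translation orbit] -/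
theorem stub_cofiniteWeilCriterion_mem_roots {f : ℝ → ℂ} (hf : IsWeilTest f) {p : Polynomial ℂ}
    (hp : p ≠ 0)
    (H : ∀ (n : ℕ) (x : Fin n → ℝ) (c : Fin n → ℂ),
      0 ≤ (weilQuadratic (fun t ↦ ∑ k, c k *
        (∑ j ∈ Finset.range (p.natDegree + 1),
          p.coeff j * (-1 : ℂ) ^ j * iteratedDeriv j f (t - x k)))).re)
    {ρ : ℂ} (hρ : ρ ∈ ZetaZeros.riemannZetaNontrivialZeros) (hre : ρ.re ≠ 1 / 2)
    (hP : WeilConverse.pairCoeff f ρ ≠ 0) :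
    ρ ∈ p.roots.toFinset.image (fun r ↦ r + 1 / 2) ∪
      p.roots.toFinset.image (fun r ↦ 1 / 2 - conj r) := by
  have h0 := stub_cofiniteWeilCriterion_order_mul_pairCoeff_eq_zero
    (stub_cofiniteWeilCriterion_isWeilTest_polyDeriv hf p) (stub_cofiniteWeilCriterion_hloc p H)
    hρ hre
  rw [stub_cofiniteWeilCriterion_pairCoeff_polyDeriv hf] at h0
  have hm : (riemannZetaZeroOrder ρ : ℂ) ≠ 0 := by
    have := ZetaZeros.riemannZetaNontrivialZeros.one_le_order hρ
    exact_mod_cast (by omega : riemannZetaZeroOrder ρ ≠ 0)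
  have h1 : p.eval (ρ - 1 / 2) = 0 ∨ p.eval (1 / 2 - conj ρ) = 0 := by
    rcases mul_eq_zero.1 h0 with h | h
    · exact absurd h hm
    rcases mul_eq_zero.1 h with h | h
    · rcases mul_eq_zero.1 h with h | h
      · exact Or.inl h
      · exact Or.inr ((map_eq_zero _).1 h)
    · exact absurd h hP
  rw [Finset.mem_union, Finset.mem_image, Finset.mem_image]
  simp_rw [Multiset.mem_toFinset, Polynomial.mem_roots hp]
  rcases h1 with h | h
  · exact Or.inl ⟨ρ - 1 / 2, h, by ring⟩
  · refine Or.inr ⟨1 / 2 - conj ρ, h, ?_⟩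
    rw [map_sub, map_div₀, map_one, map_ofNat, Complex.conj_conj, sub_sub_cancel]

/-- **Stub `stub_cofiniteWeilCriterion` — THE COFINITE WEIL CRITERION (orbit form).** If every
test function `f` admits a non-zero polynomial `p` of degree `≤ D` with `Re Q ≥ 0` on the
translation span of `h := p(-D) f`, then all but finitely many (indeed `≤ 2D`) zeros of `ζ` in the
open critical strip lie on the critical line: `ĥ(s) = p(s - 1/2) f̂(s)`; positivity on the span
contains positivity at `h` and at every `translateMix h c x`, which is all the proof of
`WeilConverse.order_mul_pairCoeff_eq_zero` uses (`zeroForm = Q` by `explicit_formula_holds` +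
`hasWeilZeroSide_zeroForm`; `BoundedPowerSum.sum_fiber_eq_zero_of_exp_real`), so
`m(ρ) ĥ(ρ) conj ĥ(1 - ρ̄) = 0` at every zero with `Re ρ ≠ 1/2`: the off-line zeros with
`f̂(ρ) conj f̂(1 - ρ̄) ≠ 0` lie in `(1/2 + roots p) ∪ (1/2 - conj roots p)`. A narrow bump `f` has
`Re f̂ > 0` on any prescribed horizontal strip, so any `2D + 1` off-line zeros are seen by one `f`:
contradiction. [cite: Bombieri2000Weil, Thm. 1 ("if" half), run inside one translation orbit] -/
theorem stub_cofiniteWeilCriterion :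
    (∃ D : ℕ, ∀ f : ℝ → ℂ, IsWeilTest f → ∃ p : Polynomial ℂ, p ≠ 0 ∧ p.natDegree ≤ D ∧
        ∀ (n : ℕ) (x : Fin n → ℝ) (c : Fin n → ℂ),
          0 ≤ (weilQuadratic (fun t => ∑ k, c k *
            (∑ j ∈ Finset.range (p.natDegree + 1),
              p.coeff j * (-1 : ℂ) ^ j * iteratedDeriv j f (t - x k)))).re) →
    {s : ℂ | riemannZeta s = 0 ∧ 0 < s.re ∧ s.re < 1 ∧ s.re ≠ 1 / 2}.Finite := by
  rintro ⟨D, hD⟩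
  by_contra hinf
  obtain ⟨S, hS, hcard⟩ := Set.Infinite.exists_subset_card_eq hinf (2 * D + 1)
  -- a common bound for the ordinates of the `2D + 1` chosen off-line zeros
  set Y : ℝ := ∑ s ∈ S, |s.im| with hY
  have hYb : ∀ s ∈ S, |s.im| ≤ Y := fun s hs ↦
    Finset.single_le_sum (f := fun s : ℂ ↦ |s.im|) (fun _ _ ↦ abs_nonneg _) hs
  -- one narrow bump sees all of them
  obtain ⟨f, hf, hpos⟩ := stub_cofiniteWeilCriterion_bump Y
  obtain ⟨p, hp0, hpD, H⟩ := hD f hf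
  set T : Finset ℂ := p.roots.toFinset.image (fun r ↦ r + 1 / 2) ∪
    p.roots.toFinset.image (fun r ↦ 1 / 2 - conj r) with hT
  have hST : S ⊆ T := by
    intro ρ hρS
    obtain ⟨h0, h1, h2, h3⟩ := hS (Finset.mem_coe.2 hρS)
    exact stub_cofiniteWeilCriterion_mem_roots hf hp0 H
      (ZetaZeros.riemannZetaNontrivialZeros.mem_iff'.2 ⟨h0, h1, h2⟩) h3
      (stub_cofiniteWeilCriterion_pairCoeff_ne_zero hpos (hYb ρ hρS))
  have hroots : p.roots.toFinset.card ≤ D :=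
    ((Multiset.toFinset_card_le (m := p.roots)).trans (Polynomial.card_roots' p)).trans hpD
  have hTcard : T.card ≤ 2 * D :=
    calc T.card ≤ (p.roots.toFinset.image (fun r ↦ r + 1 / 2)).card +
          (p.roots.toFinset.image (fun r ↦ 1 / 2 - conj r)).card := Finset.card_union_le _ _
      _ ≤ p.roots.toFinset.card + p.roots.toFinset.card :=
          add_le_add Finset.card_image_le Finset.card_image_le
      _ ≤ 2 * D := by omega
  have hle := Finset.card_le_card hST
  omega

end Summit.RiemannHypothesis.RiemannHypothesis.Theorems.RuelleBandCofiniteCriticalLine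

end
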